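import Literature.MathematicalPhysics.QuantumFieldTheory.Balaban1983to89.B9Eq346SecondLegAtCubesTorusL2
import Literature.MathematicalPhysics.QuantumFieldTheory.Balaban1983to89.B9Eq335ClassBridgePV1

/-!
# `Balaban1983to89.B9Eq346SecondLegAtCubesTorusL2Closed` — [B9] Cor 3.6 ∕ (3.46) ∕ (3.87)–(3.90): the rows-18 second-order `L²` leg `L2SecondLegs37` at the N06
# certificate's pins MODULO THE PLAQUETTE WINDOW, dag-n06-w1's member-uniform theorem `B9Eq346SecondLegAtCubesTorusL2.l2SecondLegs37_memberY_window` WITH ITS FOUR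
# EXISTENTIAL CONSTANTS NAMED — window form `MSecW aSecW BSecW δSecW` (parent §4) and LEVELLED form `MSec aSec BSec δSec` (parent §5 `l2SecondLegs37_memberY_levelled` at the coverage
# lineage's constant `C₀(K₁) = 2K₁(1+K₁)e^{4K₁}`, node00-def-Y R-W0′) — the closed terms the certificate's displayed numerics are compared with — and the schema restated AT THEM

T. Bałaban, *Propagators for lattice gauge theories in a background field*, Commun. Math. Phys. **99** (1985) 389–434 [`Balaban1985BackgroundPropagators`, "B9"],
Cor 3.6 p. 408, Thm 3.1 (3.46) p. 398, (3.87)–(3.90) pp. 409–410, (3.35) p. 396, (3.69) p. 404; T. Bałaban, *Propagators and renormalization transformations for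
lattice gauge theories. II*, Commun. Math. Phys. **96** (1984) 223–250 [`Balaban1984PropagatorsII`], (2.46) p. 231, (2.51)–(2.54) pp. 232–233, p. 235, p. 247.

statement-level skeleton of published theorems with citation tags; proofs where landed; nothing here is a claim about the Yang–Mills mass gap

WHY THIS FILE (cell `pub-ymgap`, Track A node N06 [B9]; width seat `pub-ymgap-dag-n06-w1` (g5); the drill of dag-n06-w7's `B9Eq346MixedLegAtPinsL2Closed` for the
second-order leg).  `l2SecondLegs37_memberY_window` proves, for a window scale `w₀ ≥ 0`, `∃ M₃ a₃ B₃ δ₃ > 0, ∀ hG x, M₃ ≤ M_x → ∀ α₀ > 0, c₀·M_x·α₀ ≤ a₃ → ∀ U,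
Reg335 c₀ α₀ U → (window at every cube) → ∀ bI hlev hβ1 R₀ H₀ 𝔬 𝔡 (pins), L2SecondLegs37 𝔬 𝔡 R₀ H₀ (SblkY x bI) B₃ δ₃ U`.  The certificate merges thresholds and
compares rates and constants ACROSS displayed letters, so the four constants must be TERMS: this file names them by `Classical.choose` — `MSecW aSecW BSecW δSecW`
(functions of `d ℓ hd hL b₀ b₁ M⋆ N c₀ w₀` and the proofs `hc₀ : 0 < c₀`, `hw₀ : 0 ≤ w₀`) for the window form §4, and `MSec aSec BSec δSec` (functions of `… c₀ K₁`, proofs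
`hc₀`, `hK₁ : 0 ≤ K₁`) for the LEVELLED form §5 (`l2SecondLegs37_memberY_levelled` at `C₀(K₁) = 2K₁(1+K₁)e^{4K₁}`: the window replaced by dag-n06-j's levelled plaquette
bound `∀ p, ‖U(∂p) − 1‖ ≤ 2K(1+K)e^{4K}·(L^{lev(p.src)−1})⁻²`, `K = 10L·(M·α₀) ≤ K₁`, in def-Y's letters; `windowConst_nonneg`, dag-n06-j's `plaqBound_mono`)
— and restates the schema AT THEM (`l2SecondLegs37_memberY_window_at`, `l2SecondLegs37_memberY_levelled_at`), with the positivity facts; the one-call form at the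
record's class premise (`(bg9YP …).Reg335 c35Y α₀ U`, via dag-n06-j's class bridge and levelled plaquette theorem) follows in a v1.1 append.  Nothing is re-proved; nothing of
[B9] is asserted beyond the parents.

HONEST SCOPE.  Eight named constants and two specialisations; the plaquette window near `□̃` stays a HYPOTHESIS; COUNT-NEUTRAL; N06 NOT discharged; K1 NOT closed; one
finite lattice programme — nothing continuum, nothing about OS positivity or the mass gap; the YM mass gap (Clay) is NOT proved by any of this — R4 closes the conditional
finite-𝕋⁴ rung `BalabanLadder.UV` only.
-/

noncomputable section

namespace Literature.MathematicalPhysics.QuantumFieldTheory.Balaban1983to89.B9Eq346SecondLegAtCubesTorusL2Closed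

open Literature.MathematicalPhysics.QuantumFieldTheory.Balaban1983to89
open Node00 B6KLevelCensusIndexV1 B6Geom246MultiLevelBox B6MultiLevelTorusOperator B6GlobalChartV1 B9BackgroundsKLevelV1 B6Geom246MultiLevelTorus B9Eq39Adjoint
open Literature.MathematicalPhysics.QuantumFieldTheory.Balaban1983to89.B6Ineq2142KLevelV1 (lvl β)
open Literature.MathematicalPhysics.QuantumFieldTheory.Balaban1983to89.B9Ineq349SiteComposite (cdsSL)
open Literature.MathematicalPhysics.QuantumFieldTheory.Balaban1983to89.B9CoReadingCoords (coordOpK)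
open Literature.MathematicalPhysics.QuantumFieldTheory.Balaban1983to89.B9CoReadingCoordsS (XSK blkSK sIK)
open Literature.MathematicalPhysics.QuantumFieldTheory.Balaban1983to89.B9CoReadingCoordsTranspose (TrIdx trBasis)
open Literature.MathematicalPhysics.QuantumFieldTheory.Balaban1983to89.B9PinMembersKLevelV1 (MemberY geo9Y bg9Y)
open Literature.MathematicalPhysics.QuantumFieldTheory.Balaban1983to89.B9Thm37Whole (Ops)
open Literature.MathematicalPhysics.QuantumFieldTheory.Balaban1983to89.B9RWSums346SecondDiffGp (DirOps37 L2SecondLegs37)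
open Literature.MathematicalPhysics.QuantumFieldTheory.Balaban1983to89.B6Cover236MultiLevelBlocks (cubes)
open Literature.MathematicalPhysics.QuantumFieldTheory.Balaban1983to89.B9WalkLettersCoordsS (cubeDomY SblkY hWalkY gsqcoS)
open Literature.MathematicalPhysics.QuantumFieldTheory.Balaban1983to89.B9Eq346SecondLegAtCubesTorusL2 (l2SecondLegs37_memberY_window l2SecondLegs37_memberY_levelled)
open scoped Matrix Matrix.Norms.L2Operator

variable (d ℓ : ℕ) (hd : 1 ≤ d + 1) (hL : Odd (ℓ + 1) ∧ 1 < ℓ + 1) (b₀ b₁ : ℝ) (Mstar N : ℕ) [NeZero N] (c₀ : ℝ) (hc₀ : 0 < c₀) (w₀ : ℝ) (hw₀ : 0 ≤ w₀)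

/-- **THE THRESHOLD `M₃` OF THE ROWS-18 SECOND-ORDER `L²` LEG, NAMED**: the first existential constant of `l2SecondLegs37_memberY_window` (a function of the member family's
data `d ℓ b₀ b₁ M⋆ N`, the class constant `c₀` and the window scale `w₀`). [cite: Balaban1985BackgroundPropagators, Cor 3.6 p.408, (3.46) p.398] -/
def MSecW : ℝ := (l2SecondLegs37_memberY_window d ℓ hd hL b₀ b₁ Mstar N hc₀ hw₀).choose

/-- **THE SMALLNESS THRESHOLD `a₃` (`c₀·M·α₀ ≤ a₃`) OF THE ROWS-18 SECOND-ORDER `L²` LEG, NAMED** (second existential constant).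
[cite: Balaban1985BackgroundPropagators, Cor 3.6 p.408, (3.35) p.396] -/
def aSecW : ℝ := (l2SecondLegs37_memberY_window d ℓ hd hL b₀ b₁ Mstar N hc₀ hw₀).choose_spec.choose

/-- **THE CONSTANT `B₃` OF THE ROWS-18 SECOND-ORDER `L²` LEG, NAMED** (third existential constant; print's `B₀` of (3.46) at `G′_□`, Cor 3.6 «independent of □»).
[cite: Balaban1985BackgroundPropagators, Cor 3.6 p.408, (3.46) p.398] -/
def BSecW : ℝ := (l2SecondLegs37_memberY_window d ℓ hd hL b₀ b₁ Mstar N hc₀ hw₀).choose_spec.choose_spec.choose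

/-- **THE DECAY RATE `δ₃` OF THE ROWS-18 SECOND-ORDER `L²` LEG, NAMED** (fourth existential constant) — the closed term the certificate's rate comparison refers to.
[cite: Balaban1985BackgroundPropagators, Cor 3.6 p.408, (3.46) p.398] -/
def δSecW : ℝ := (l2SecondLegs37_memberY_window d ℓ hd hL b₀ b₁ Mstar N hc₀ hw₀).choose_spec.choose_spec.choose_spec.choose

/-- The defining property of the four named constants (the parent theorem, unpacked once). [cite: Balaban1985BackgroundPropagators, Cor 3.6 p.408, (3.46) p.398, bookkeeping] -/
private theorem specSecW : 0 < MSecW d ℓ hd hL b₀ b₁ Mstar N c₀ hc₀ w₀ hw₀ ∧ 0 < aSecW d ℓ hd hL b₀ b₁ Mstar N c₀ hc₀ w₀ hw₀ ∧ 0 < BSecW d ℓ hd hL b₀ b₁ Mstar N c₀ hc₀ w₀ hw₀ ∧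
    0 < δSecW d ℓ hd hL b₀ b₁ Mstar N c₀ hc₀ w₀ hw₀ ∧
    ∀ {G : Subgroup (Matrix (Fin N) (Fin N) ℂ)ˣ} (_ : G ≤ B7Prop2Explicit.unitaryUnits (Matrix (Fin N) (Fin N) ℂ))
      (x : MemberY d ℓ hd hL b₀ b₁ Mstar), MSecW d ℓ hd hL b₀ b₁ Mstar N c₀ hc₀ w₀ hw₀ ≤ (geo9Y x).M → ∀ α₀ : ℝ, 0 < α₀ →
      c₀ * (geo9Y x).M * α₀ ≤ aSecW d ℓ hd hL b₀ b₁ Mstar N c₀ hc₀ w₀ hw₀ →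
      ∀ (U : (bg9Y (Matrix (Fin N) (Fin N) ℂ) G x).Cfg), (bg9Y (Matrix (Fin N) (Fin N) ℂ) G x).Reg335 c₀ α₀ U →
      (∀ (c : ↥(cubes x.toKIdx.D.toDomains)) (z : SiteY x.toKIdx),
          ((∃ μ, shiftY x.toKIdx μ z ∈ cubeDomY x c) ∨ (∃ μ ν, shiftY x.toKIdx ν (shiftY x.toKIdx μ z) ∈ cubeDomY x c)) →
          ∀ μ ν : Fin (d + 1), ‖((plaqU (shiftY x.toKIdx) (UboxY x.toKIdx U) μ ν z : (Matrix (Fin N) (Fin N) ℂ)ˣ) : Matrix (Fin N) (Fin N) ℂ) - 1‖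
            ≤ w₀ / ((((ℓ + 1) ^ (c.1.1 - 1 + 2) : ℕ) : ℝ)) ^ 2) →
      ∀ {bI : FBondY x.toKIdx → IBondY x.toKIdx} (_ : ∀ f, lvl x.hN x.D x.hk (bI f) = (blkV1 x.hN x.D f).1.1)
        (_ : ∀ f, (geomT x.D).dist (β x.hN x.D x.hk (bI f)) (blkV1 x.hN x.D f) ≤ 1) (R₀ : ℝ) (H₀ : Prop) [Fintype (geo9Y x).Site] [DecidableEq (geo9Y x).Site]
        {Y : Type} (𝔬 : Ops (geo9Y x) (bg9Y (Matrix (Fin N) (Fin N) ℂ) G x) (XSK (TrIdx N) x.toKIdx) Y ↥(cubes x.toKIdx.D.toDomains)) (𝔡 : DirOps37 𝔬 (Fin (d + 1)))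
        (_ : 𝔬.blk = blkSK x.toKIdx (sIK x.toKIdx bI)) (_ : ∀ c, 𝔬.h c = hWalkY x c)
        (_ : ∀ c, 𝔬.Gsq U c = gsqcoS x (trBasis N) (bg9Y (Matrix (Fin N) (Fin N) ℂ) G x) (fun U => U) (parSymY x.toKIdx) c U)
        (_ : ∀ μ, 𝔡.Dsd U μ = (etaS x.toKIdx)⁻¹ • coordOpK (trBasis N) (fun _ : Fin (d + 1) => (cdsSL x.toKIdx U μ).restrictScalars ℝ)),
        L2SecondLegs37 𝔬 𝔡 R₀ H₀ (SblkY x bI) (BSecW d ℓ hd hL b₀ b₁ Mstar N c₀ hc₀ w₀ hw₀) (δSecW d ℓ hd hL b₀ b₁ Mstar N c₀ hc₀ w₀ hw₀) U :=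
  (l2SecondLegs37_memberY_window d ℓ hd hL b₀ b₁ Mstar N hc₀ hw₀).choose_spec.choose_spec.choose_spec.choose_spec

/-- `0 < MSecW`. [cite: Balaban1985BackgroundPropagators, Cor 3.6 p.408, bookkeeping] -/
theorem MSecW_pos : 0 < MSecW d ℓ hd hL b₀ b₁ Mstar N c₀ hc₀ w₀ hw₀ := (specSecW d ℓ hd hL b₀ b₁ Mstar N c₀ hc₀ w₀ hw₀).1

/-- `0 < aSecW`. [cite: Balaban1985BackgroundPropagators, Cor 3.6 p.408, bookkeeping] -/
theorem aSecW_pos : 0 < aSecW d ℓ hd hL b₀ b₁ Mstar N c₀ hc₀ w₀ hw₀ := (specSecW d ℓ hd hL b₀ b₁ Mstar N c₀ hc₀ w₀ hw₀).2.1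

/-- `0 < BSecW`. [cite: Balaban1985BackgroundPropagators, Cor 3.6 p.408, bookkeeping] -/
theorem BSecW_pos : 0 < BSecW d ℓ hd hL b₀ b₁ Mstar N c₀ hc₀ w₀ hw₀ := (specSecW d ℓ hd hL b₀ b₁ Mstar N c₀ hc₀ w₀ hw₀).2.2.1

/-- `0 < δSecW`. [cite: Balaban1985BackgroundPropagators, Cor 3.6 p.408, bookkeeping] -/
theorem δSecW_pos : 0 < δSecW d ℓ hd hL b₀ b₁ Mstar N c₀ hc₀ w₀ hw₀ := (specSecW d ℓ hd hL b₀ b₁ Mstar N c₀ hc₀ w₀ hw₀).2.2.2.1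

/-- ★★★ **THE SCHEMA `L2SecondLegs37` AT THE NAMED CONSTANTS, MODULO THE PLAQUETTE WINDOW** (`ι := cubes`, every cube pinned; the indicator decided by the certificate's own
`DecidableEq (geo9Y x).Site`): for every member `x` with `MSecW ≤ M_x`, every `α₀ > 0` with `c₀·M_x·α₀ ≤ aSecW`, every configuration `U` of the (3.35) class whose plaquette
variables within two lattice steps of each `□̃(c)` are within `w₀∕L^{2((j(c)−1)+2)}` of `1`, every faithful `bI`, `R₀ H₀`, and every walk-letter record `𝔬 𝔡` satisfying the
pins: `L2SecondLegs37 𝔬 𝔡 R₀ H₀ (SblkY x bI) BSecW δSecW U` — the type of the N06 certificate's rows-18 conjunct at `S3 x := SblkY x (bI x)`, constant `BSecW`, rate `δSecW`.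
[cite: Balaban1985BackgroundPropagators, Cor 3.6 p.408, Thm 3.1 (3.46) p.398, (3.87)–(3.90) pp.409–410, (3.35) p.396, (3.69) p.404; Balaban1984PropagatorsII, (2.46) p.231, (2.51)–(2.54) pp.232–233, p.235, p.247] -/
theorem l2SecondLegs37_memberY_window_at {G : Subgroup (Matrix (Fin N) (Fin N) ℂ)ˣ} (hG : G ≤ B7Prop2Explicit.unitaryUnits (Matrix (Fin N) (Fin N) ℂ))
    (x : MemberY d ℓ hd hL b₀ b₁ Mstar) (hM : MSecW d ℓ hd hL b₀ b₁ Mstar N c₀ hc₀ w₀ hw₀ ≤ (geo9Y x).M) (α₀ : ℝ) (hα₀ : 0 < α₀)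
    (ha : c₀ * (geo9Y x).M * α₀ ≤ aSecW d ℓ hd hL b₀ b₁ Mstar N c₀ hc₀ w₀ hw₀)
    (U : (bg9Y (Matrix (Fin N) (Fin N) ℂ) G x).Cfg) (hU : (bg9Y (Matrix (Fin N) (Fin N) ℂ) G x).Reg335 c₀ α₀ U)
    (hW : ∀ (c : ↥(cubes x.toKIdx.D.toDomains)) (z : SiteY x.toKIdx),
        ((∃ μ, shiftY x.toKIdx μ z ∈ cubeDomY x c) ∨ (∃ μ ν, shiftY x.toKIdx ν (shiftY x.toKIdx μ z) ∈ cubeDomY x c)) →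
        ∀ μ ν : Fin (d + 1), ‖((plaqU (shiftY x.toKIdx) (UboxY x.toKIdx U) μ ν z : (Matrix (Fin N) (Fin N) ℂ)ˣ) : Matrix (Fin N) (Fin N) ℂ) - 1‖
          ≤ w₀ / ((((ℓ + 1) ^ (c.1.1 - 1 + 2) : ℕ) : ℝ)) ^ 2)
    {bI : FBondY x.toKIdx → IBondY x.toKIdx} (hlev : ∀ f, lvl x.hN x.D x.hk (bI f) = (blkV1 x.hN x.D f).1.1)
    (hβ1 : ∀ f, (geomT x.D).dist (β x.hN x.D x.hk (bI f)) (blkV1 x.hN x.D f) ≤ 1) (R₀ : ℝ) (H₀ : Prop) [Fintype (geo9Y x).Site] [DecidableEq (geo9Y x).Site]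
    {Y : Type} (𝔬 : Ops (geo9Y x) (bg9Y (Matrix (Fin N) (Fin N) ℂ) G x) (XSK (TrIdx N) x.toKIdx) Y ↥(cubes x.toKIdx.D.toDomains)) (𝔡 : DirOps37 𝔬 (Fin (d + 1)))
    (hblk : 𝔬.blk = blkSK x.toKIdx (sIK x.toKIdx bI)) (hh : ∀ c, 𝔬.h c = hWalkY x c)
    (hGsq : ∀ c, 𝔬.Gsq U c = gsqcoS x (trBasis N) (bg9Y (Matrix (Fin N) (Fin N) ℂ) G x) (fun U => U) (parSymY x.toKIdx) c U)
    (hDsd : ∀ μ, 𝔡.Dsd U μ = (etaS x.toKIdx)⁻¹ • coordOpK (trBasis N) (fun _ : Fin (d + 1) => (cdsSL x.toKIdx U μ).restrictScalars ℝ)) :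
    L2SecondLegs37 𝔬 𝔡 R₀ H₀ (SblkY x bI) (BSecW d ℓ hd hL b₀ b₁ Mstar N c₀ hc₀ w₀ hw₀) (δSecW d ℓ hd hL b₀ b₁ Mstar N c₀ hc₀ w₀ hw₀) U :=
  (specSecW d ℓ hd hL b₀ b₁ Mstar N c₀ hc₀ w₀ hw₀).2.2.2.2 hG x hM α₀ hα₀ ha U hU hW hlev hβ1 R₀ H₀ 𝔬 𝔡 hblk hh hGsq hDsd

/-! ## The LEVELLED form (parent §5 `l2SecondLegs37_memberY_levelled`) at the window constant `C₀(K₁) = 2K₁(1+K₁)e^{4K₁}` of the coverage lineage -/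

section Levelled

/-- the (3.69)-constant `2K(1+K)e^{4K}` of dag-n06-j's levelled plaquette theorem (`B9Eq335CoveragePAtLettersY.norm_holY_sub_one_le_levelled_of_reg335P`,
`K = 10L·(M·α₀)`) is `≥ 0` for `K ≥ 0`. [cite: Balaban1985BackgroundPropagators, (3.69) p.404, bookkeeping] -/
theorem windowConst_nonneg {K : ℝ} (hK : 0 ≤ K) : 0 ≤ 2 * K * (1 + K) * Real.exp (4 * K) := by positivity

-- monotonicity of `K ↦ 2K(1+K)e^{4K}` on `K ≥ 0` is dag-n06-j's `B9Eq335CoveragePAtLettersY.plaqBound_mono` (by name at the call site; not restated here).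

variable (K₁ : ℝ) (hK₁ : 0 ≤ K₁)

/-- **THE THRESHOLD `M₃` OF THE ROWS-18 SECOND-ORDER `L²` LEG, LEVELLED FORM AT `C₀(K₁)`, NAMED** (first existential constant of `l2SecondLegs37_memberY_levelled` at
`C₀ := 2K₁(1+K₁)e^{4K₁}`; a function of `d ℓ b₀ b₁ M⋆ N c₀ K₁`). [cite: Balaban1985BackgroundPropagators, Cor 3.6 p.408, (3.46) p.398] -/
def MSec : ℝ := (l2SecondLegs37_memberY_levelled d ℓ hd hL b₀ b₁ Mstar N hc₀ (windowConst_nonneg hK₁)).choose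

/-- **THE SMALLNESS THRESHOLD `a₃`, LEVELLED FORM, NAMED** (second existential constant). [cite: Balaban1985BackgroundPropagators, Cor 3.6 p.408, (3.35) p.396] -/
def aSec : ℝ := (l2SecondLegs37_memberY_levelled d ℓ hd hL b₀ b₁ Mstar N hc₀ (windowConst_nonneg hK₁)).choose_spec.choose

/-- **THE CONSTANT `B₃`, LEVELLED FORM, NAMED** (third existential constant). [cite: Balaban1985BackgroundPropagators, Cor 3.6 p.408, (3.46) p.398] -/
def BSec : ℝ := (l2SecondLegs37_memberY_levelled d ℓ hd hL b₀ b₁ Mstar N hc₀ (windowConst_nonneg hK₁)).choose_spec.choose_spec.choose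

/-- **THE DECAY RATE `δ₃`, LEVELLED FORM, NAMED** (fourth existential constant). [cite: Balaban1985BackgroundPropagators, Cor 3.6 p.408, (3.46) p.398] -/
def δSec : ℝ := (l2SecondLegs37_memberY_levelled d ℓ hd hL b₀ b₁ Mstar N hc₀ (windowConst_nonneg hK₁)).choose_spec.choose_spec.choose_spec.choose

/-- The defining property of the four levelled constants (the parent theorem at `C₀(K₁)`, unpacked once). [cite: Balaban1985BackgroundPropagators, Cor 3.6 p.408, (3.46) p.398, bookkeeping] -/
private theorem specSec : 0 < MSec d ℓ hd hL b₀ b₁ Mstar N c₀ hc₀ K₁ hK₁ ∧ 0 < aSec d ℓ hd hL b₀ b₁ Mstar N c₀ hc₀ K₁ hK₁ ∧ 0 < BSec d ℓ hd hL b₀ b₁ Mstar N c₀ hc₀ K₁ hK₁ ∧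
    0 < δSec d ℓ hd hL b₀ b₁ Mstar N c₀ hc₀ K₁ hK₁ ∧
    ∀ {G : Subgroup (Matrix (Fin N) (Fin N) ℂ)ˣ} (_ : G ≤ B7Prop2Explicit.unitaryUnits (Matrix (Fin N) (Fin N) ℂ))
      (x : MemberY d ℓ hd hL b₀ b₁ Mstar), MSec d ℓ hd hL b₀ b₁ Mstar N c₀ hc₀ K₁ hK₁ ≤ (geo9Y x).M → ∀ α₀ : ℝ, 0 < α₀ →
      c₀ * (geo9Y x).M * α₀ ≤ aSec d ℓ hd hL b₀ b₁ Mstar N c₀ hc₀ K₁ hK₁ →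
      ∀ (U : (bg9Y (Matrix (Fin N) (Fin N) ℂ) G x).Cfg), (bg9Y (Matrix (Fin N) (Fin N) ℂ) G x).Reg335 c₀ α₀ U →
      (∀ p : PlaqY x.toKIdx, ‖((holY x.toKIdx U p : (Matrix (Fin N) (Fin N) ℂ)ˣ) : Matrix (Fin N) (Fin N) ℂ) - 1‖
          ≤ 2 * K₁ * (1 + K₁) * Real.exp (4 * K₁) * (((kGeo x.toKIdx).L ^ (levV1 x.toKIdx p.src - 1))⁻¹) ^ 2) →
      ∀ {bI : FBondY x.toKIdx → IBondY x.toKIdx} (_ : ∀ f, lvl x.hN x.D x.hk (bI f) = (blkV1 x.hN x.D f).1.1)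
        (_ : ∀ f, (geomT x.D).dist (β x.hN x.D x.hk (bI f)) (blkV1 x.hN x.D f) ≤ 1) (R₀ : ℝ) (H₀ : Prop) [Fintype (geo9Y x).Site] [DecidableEq (geo9Y x).Site]
        {Y : Type} (𝔬 : Ops (geo9Y x) (bg9Y (Matrix (Fin N) (Fin N) ℂ) G x) (XSK (TrIdx N) x.toKIdx) Y ↥(cubes x.toKIdx.D.toDomains)) (𝔡 : DirOps37 𝔬 (Fin (d + 1)))
        (_ : 𝔬.blk = blkSK x.toKIdx (sIK x.toKIdx bI)) (_ : ∀ c, 𝔬.h c = hWalkY x c)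
        (_ : ∀ c, 𝔬.Gsq U c = gsqcoS x (trBasis N) (bg9Y (Matrix (Fin N) (Fin N) ℂ) G x) (fun U => U) (parSymY x.toKIdx) c U)
        (_ : ∀ μ, 𝔡.Dsd U μ = (etaS x.toKIdx)⁻¹ • coordOpK (trBasis N) (fun _ : Fin (d + 1) => (cdsSL x.toKIdx U μ).restrictScalars ℝ)),
        L2SecondLegs37 𝔬 𝔡 R₀ H₀ (SblkY x bI) (BSec d ℓ hd hL b₀ b₁ Mstar N c₀ hc₀ K₁ hK₁) (δSec d ℓ hd hL b₀ b₁ Mstar N c₀ hc₀ K₁ hK₁) U :=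
  (l2SecondLegs37_memberY_levelled d ℓ hd hL b₀ b₁ Mstar N hc₀ (windowConst_nonneg hK₁)).choose_spec.choose_spec.choose_spec.choose_spec

/-- `0 < MSec`. [cite: Balaban1985BackgroundPropagators, Cor 3.6 p.408, bookkeeping] -/
theorem MSec_pos : 0 < MSec d ℓ hd hL b₀ b₁ Mstar N c₀ hc₀ K₁ hK₁ := (specSec d ℓ hd hL b₀ b₁ Mstar N c₀ hc₀ K₁ hK₁).1

/-- `0 < aSec`. [cite: Balaban1985BackgroundPropagators, Cor 3.6 p.408, bookkeeping] -/
theorem aSec_pos : 0 < aSec d ℓ hd hL b₀ b₁ Mstar N c₀ hc₀ K₁ hK₁ := (specSec d ℓ hd hL b₀ b₁ Mstar N c₀ hc₀ K₁ hK₁).2.1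

/-- `0 < BSec`. [cite: Balaban1985BackgroundPropagators, Cor 3.6 p.408, bookkeeping] -/
theorem BSec_pos : 0 < BSec d ℓ hd hL b₀ b₁ Mstar N c₀ hc₀ K₁ hK₁ := (specSec d ℓ hd hL b₀ b₁ Mstar N c₀ hc₀ K₁ hK₁).2.2.1

/-- `0 < δSec`. [cite: Balaban1985BackgroundPropagators, Cor 3.6 p.408, bookkeeping] -/
theorem δSec_pos : 0 < δSec d ℓ hd hL b₀ b₁ Mstar N c₀ hc₀ K₁ hK₁ := (specSec d ℓ hd hL b₀ b₁ Mstar N c₀ hc₀ K₁ hK₁).2.2.2.1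

/-- ★★★ **THE SCHEMA `L2SecondLegs37` AT THE NAMED LEVELLED CONSTANTS, FED BY THE COVERAGE LINEAGE's PRINTED BOUND** (`ι := cubes`): for every member `x` with `MSec ≤ M_x`,
every `α₀ > 0` with `c₀·M_x·α₀ ≤ aSec`, every configuration `U` of the (3.35) class whose plaquette variables satisfy, at every plaquette, `‖U(∂p) − 1‖ ≤ C_K·(L^{lev(p.src)−1})⁻²` for
SOME constant `C_K ≤ 2K₁(1+K₁)e^{4K₁}` (dag-n06-j's levelled theorem gives `C_K = 2K(1+K)e^{4K}`, `K = 10L·(M·α₀)`: use `B9Eq335CoveragePAtLettersY.plaqBound_mono` with `K ≤ K₁`), every faithful `bI`,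
`R₀ H₀`, and every walk-letter record `𝔬 𝔡` satisfying the pins: `L2SecondLegs37 𝔬 𝔡 R₀ H₀ (SblkY x bI) BSec δSec U`.
[cite: Balaban1985BackgroundPropagators, Cor 3.6 p.408, Thm 3.1 (3.46) p.398, (3.87)–(3.90) pp.409–410, (3.35) p.396, (3.69) p.404; Balaban1984PropagatorsII, (2.46) p.231, (2.51)–(2.54) pp.232–233, p.235, p.247] -/
theorem l2SecondLegs37_memberY_levelled_at {G : Subgroup (Matrix (Fin N) (Fin N) ℂ)ˣ} (hG : G ≤ B7Prop2Explicit.unitaryUnits (Matrix (Fin N) (Fin N) ℂ))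
    (x : MemberY d ℓ hd hL b₀ b₁ Mstar) (hM : MSec d ℓ hd hL b₀ b₁ Mstar N c₀ hc₀ K₁ hK₁ ≤ (geo9Y x).M) (α₀ : ℝ) (hα₀ : 0 < α₀)
    (ha : c₀ * (geo9Y x).M * α₀ ≤ aSec d ℓ hd hL b₀ b₁ Mstar N c₀ hc₀ K₁ hK₁)
    (U : (bg9Y (Matrix (Fin N) (Fin N) ℂ) G x).Cfg) (hU : (bg9Y (Matrix (Fin N) (Fin N) ℂ) G x).Reg335 c₀ α₀ U)
    {CK : ℝ} (hCK : CK ≤ 2 * K₁ * (1 + K₁) * Real.exp (4 * K₁))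
    (hlev : ∀ p : PlaqY x.toKIdx, ‖((holY x.toKIdx U p : (Matrix (Fin N) (Fin N) ℂ)ˣ) : Matrix (Fin N) (Fin N) ℂ) - 1‖
      ≤ CK * (((kGeo x.toKIdx).L ^ (levV1 x.toKIdx p.src - 1))⁻¹) ^ 2)
    {bI : FBondY x.toKIdx → IBondY x.toKIdx} (hlev1 : ∀ f, lvl x.hN x.D x.hk (bI f) = (blkV1 x.hN x.D f).1.1)
    (hβ1 : ∀ f, (geomT x.D).dist (β x.hN x.D x.hk (bI f)) (blkV1 x.hN x.D f) ≤ 1) (R₀ : ℝ) (H₀ : Prop) [Fintype (geo9Y x).Site] [DecidableEq (geo9Y x).Site]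
    {Y : Type} (𝔬 : Ops (geo9Y x) (bg9Y (Matrix (Fin N) (Fin N) ℂ) G x) (XSK (TrIdx N) x.toKIdx) Y ↥(cubes x.toKIdx.D.toDomains)) (𝔡 : DirOps37 𝔬 (Fin (d + 1)))
    (hblk : 𝔬.blk = blkSK x.toKIdx (sIK x.toKIdx bI)) (hh : ∀ c, 𝔬.h c = hWalkY x c)
    (hGsq : ∀ c, 𝔬.Gsq U c = gsqcoS x (trBasis N) (bg9Y (Matrix (Fin N) (Fin N) ℂ) G x) (fun U => U) (parSymY x.toKIdx) c U)
    (hDsd : ∀ μ, 𝔡.Dsd U μ = (etaS x.toKIdx)⁻¹ • coordOpK (trBasis N) (fun _ : Fin (d + 1) => (cdsSL x.toKIdx U μ).restrictScalars ℝ)) :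
    L2SecondLegs37 𝔬 𝔡 R₀ H₀ (SblkY x bI) (BSec d ℓ hd hL b₀ b₁ Mstar N c₀ hc₀ K₁ hK₁) (δSec d ℓ hd hL b₀ b₁ Mstar N c₀ hc₀ K₁ hK₁) U :=
  (specSec d ℓ hd hL b₀ b₁ Mstar N c₀ hc₀ K₁ hK₁).2.2.2.2 hG x hM α₀ hα₀ ha U hU
    (fun p => (hlev p).trans (mul_le_mul_of_nonneg_right hCK (sq_nonneg _))) hlev1 hβ1 R₀ H₀ 𝔬 𝔡 hblk hh hGsq hDsd

end Levelled


/-! ## v1.1 (append-only) — At the record's class premise (node00-def-Y RULING-W′: print's class `(bg9YP …).Reg335 c35Y α₀`, CASCADE-R STEP 3) -/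

section RecordClass

open Literature.MathematicalPhysics.QuantumFieldTheory.Balaban1983to89.B9BackgroundsKLevelV1P (bg9YP)

variable (K₁ : ℝ) (hK₁ : 0 ≤ K₁)

/-- ★★★ **ROWS 18's `L2SecondLegs37` AT THE PINS FROM THE RECORD's CLASS PREMISE + dag-n06-j's LEVELLED PLAQUETTE BOUND IN ITS PRINTED SHAPE** (print's class
`(bg9YP …).Reg335 c35Y α₀ U`, STEP 3): the small-cube premise of §5 at `c₀ = 10L³` is dag-n06-j's bridge `B9Eq335ClassBridgePV1.regY335_of_regYP335_c35Y`; the levelled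
plaquette bound enters as the hypothesis `hlevK` in EXACTLY the shape of dag-n06-j's `B9Eq335CoveragePAtLettersY.norm_holY_sub_one_le_levelled_of_regYP335_c35Y x hα₀.le hP`
(constant `2K(1+K)e^{4K}`, `K = 10L·(M·α₀)`; supply that term for it), and is brought to the uniform `C₀(K₁)` by dag-n06-j's `plaqBound_mono` under the displayed `K ≤ K₁`;
so, for every member `x` with `MSec ≤ M_x` (constants at `c₀ := 10L³`), `α₀ > 0` with `10L³·M_x·α₀ ≤ aSec` and `10L·(M_x·α₀) ≤ K₁`, every `U` of print's class, every
faithful `bI`, `R₀ H₀` and every walk-letter record satisfying the pins: `L2SecondLegs37 𝔬 𝔡 R₀ H₀ (SblkY x bI) BSec δSec U`.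
[cite: Balaban1985BackgroundPropagators, Cor 3.6 p.408, Thm 3.1 (3.46) p.398, (3.87)–(3.90) pp.409–410, (3.35) p.396 («≧ 10»), (3.69) p.404; Balaban1984PropagatorsII, (2.46) p.231, (2.51)–(2.54) pp.232–233, p.235, p.247] -/
theorem l2SecondLegs37_memberY_regYP335_of_levelled_at {G : Subgroup (Matrix (Fin N) (Fin N) ℂ)ˣ}
    (hG : G ≤ B7Prop2Explicit.unitaryUnits (Matrix (Fin N) (Fin N) ℂ))
    (hL3 : 0 < 10 * (((ℓ + 1 : ℕ) : ℝ)) ^ 3)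
    (x : MemberY d ℓ hd hL b₀ b₁ Mstar) (hM : MSec d ℓ hd hL b₀ b₁ Mstar N (10 * (((ℓ + 1 : ℕ) : ℝ)) ^ 3) hL3 K₁ hK₁ ≤ (geo9Y x).M) (α₀ : ℝ) (hα₀ : 0 < α₀)
    (ha : 10 * (((ℓ + 1 : ℕ) : ℝ)) ^ 3 * (geo9Y x).M * α₀ ≤ aSec d ℓ hd hL b₀ b₁ Mstar N (10 * (((ℓ + 1 : ℕ) : ℝ)) ^ 3) hL3 K₁ hK₁)
    (hK : 10 * (kGeo x.toKIdx).L * ((kGeo x.toKIdx).M * α₀) ≤ K₁)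
    (U : (bg9YP (Matrix (Fin N) (Fin N) ℂ) G x).Cfg) (hP : (bg9YP (Matrix (Fin N) (Fin N) ℂ) G x).Reg335 B9PinGeometryKLevelV1.c35Y α₀ U)
    (hlevK : ∀ p : PlaqY x.toKIdx, ‖((holY x.toKIdx U p : (Matrix (Fin N) (Fin N) ℂ)ˣ) : Matrix (Fin N) (Fin N) ℂ) - 1‖ ≤
      2 * (10 * (kGeo x.toKIdx).L * ((kGeo x.toKIdx).M * α₀)) * (1 + 10 * (kGeo x.toKIdx).L * ((kGeo x.toKIdx).M * α₀)) *
          Real.exp (4 * (10 * (kGeo x.toKIdx).L * ((kGeo x.toKIdx).M * α₀)))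
        * (((kGeo x.toKIdx).L ^ (levV1 x.toKIdx p.src - 1))⁻¹) ^ 2)
    {bI : FBondY x.toKIdx → IBondY x.toKIdx} (hlev1 : ∀ f, lvl x.hN x.D x.hk (bI f) = (blkV1 x.hN x.D f).1.1)
    (hβ1 : ∀ f, (geomT x.D).dist (β x.hN x.D x.hk (bI f)) (blkV1 x.hN x.D f) ≤ 1) (R₀ : ℝ) (H₀ : Prop) [Fintype (geo9Y x).Site] [DecidableEq (geo9Y x).Site]
    {Y : Type} (𝔬 : Ops (geo9Y x) (bg9Y (Matrix (Fin N) (Fin N) ℂ) G x) (XSK (TrIdx N) x.toKIdx) Y ↥(cubes x.toKIdx.D.toDomains)) (𝔡 : DirOps37 𝔬 (Fin (d + 1)))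
    (hblk : 𝔬.blk = blkSK x.toKIdx (sIK x.toKIdx bI)) (hh : ∀ c, 𝔬.h c = hWalkY x c)
    (hGsq : ∀ c, 𝔬.Gsq U c = gsqcoS x (trBasis N) (bg9Y (Matrix (Fin N) (Fin N) ℂ) G x) (fun U => U) (parSymY x.toKIdx) c U)
    (hDsd : ∀ μ, 𝔡.Dsd U μ = (etaS x.toKIdx)⁻¹ • coordOpK (trBasis N) (fun _ : Fin (d + 1) => (cdsSL x.toKIdx U μ).restrictScalars ℝ)) :
    L2SecondLegs37 𝔬 𝔡 R₀ H₀ (SblkY x bI) (BSec d ℓ hd hL b₀ b₁ Mstar N (10 * (((ℓ + 1 : ℕ) : ℝ)) ^ 3) hL3 K₁ hK₁)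
      (δSec d ℓ hd hL b₀ b₁ Mstar N (10 * (((ℓ + 1 : ℕ) : ℝ)) ^ 3) hL3 K₁ hK₁) U := by
  have hU : (bg9Y (Matrix (Fin N) (Fin N) ℂ) G x).Reg335 (10 * (((ℓ + 1 : ℕ) : ℝ)) ^ 3) α₀ U :=
    B9Eq335ClassBridgePV1.regY335_of_regYP335_c35Y x hα₀.le hP
  have hMnn : 0 ≤ (kGeo x.toKIdx).M := by
    show 0 ≤ (((ℓ + 1 : ℕ) : ℝ)) * (x.toKIdx.Mh : ℝ)
    positivity
  have hLnn : 0 ≤ (kGeo x.toKIdx).L := by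
    show (0 : ℝ) ≤ (((ℓ + 1 : ℕ) : ℝ))
    positivity
  have hK0 : 0 ≤ 10 * (kGeo x.toKIdx).L * ((kGeo x.toKIdx).M * α₀) := by positivity
  exact l2SecondLegs37_memberY_levelled_at d ℓ hd hL b₀ b₁ Mstar N (10 * (((ℓ + 1 : ℕ) : ℝ)) ^ 3) hL3 K₁ hK₁ hG x hM α₀ hα₀ ha U hU
    (B9Eq335CoveragePAtLettersY.plaqBound_mono hK0 hK) hlevK hlev1 hβ1 R₀ H₀ 𝔬 𝔡 hblk hh hGsq hDsd

end RecordClass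

end Literature.MathematicalPhysics.QuantumFieldTheory.Balaban1983to89.B9Eq346SecondLegAtCubesTorusL2Closed

end
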